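import Summits.KontsevichZagierPeriods.KontsevichZagierPeriods.Theorems.TerasomaMultiplicationMultiplicationAccessibleLiouvilleGlue
import Literature.NumberTheory.Transcendental.KZBetaChains

/-!
# `MultiplicationAccessible` (stmt-KontsevichZagierPeriods-12305), line `shifted-family-prime-sieve`:
the `x`-TRANSLATION of the shifted family — `GM(m; x+1, s) → GM(m; x, s)`

The shifted Gauss-multiplication family `GM(m; x, s)` (`n = m + 1`: every box representation of
`∏_(k<n) B(x + k/n, s)` is equivalent, under the moves of Kontsevich–Zagier 2001 §1.2, to every box
representation of `n^(ns) B(nx, ns) ∏_(j=1)^m B(js, s)`, pinned exactly as in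
`Theorems/TerasomaMultiplicationMultiplicationAccessibleSieve.lean`) at the parameter `x + 1` implies
it at `x` (`gm_of_gm_succ_x`, registered sub-goal of the line). This normalises the `x`-range of the
line's residual (`∀ x > 0 ⟸ ∀ x > 1`), which the Liouville (rotation-flow) Stokes argument needs.

Everything is book-keeping in the formal period ring `P = KZ.FormalPeriodRing` with the Beta classes
`g(p, q) = ⟦β(p, q)⟧` of a pinned Beta family (`MultGlue.exists_betaFamily`) and the rational point
constants `⟦[pt, q]⟧`, `q ∈ ℚ` (multiplicative in `q`, `TranslateX.ptQ_mul`/`ptQ_prod`; a nonzero one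
cancels, `TranslateX.ptQ_cancel`):
* translation `⟦a+b⟧ g(a, b+1) = ⟦b⟧ g(a, b)` — ONE Newton–Leibniz move (`KZ.betaTranslation_equivalent`),
  and with two reflections (`Doubling.refl_eq`) `⟦a+b⟧ g(a+1, b) = ⟦a⟧ g(a, b)` (`TranslateX.transl_fst_eq`);
* on the left every factor `g(x + k/n + 1, s)` is translated once, on the right `g(nx + n, ns)` is
  translated `n` times (`TranslateX.transl_fst_iter_eq`); the two rational constants so produced agree
  (`TranslateX.const_eq`: `∏(x+k/n)·∏(nx+ns+i) = ∏(x+k/n+s)·∏(nx+i)`, termwise), and a nonzero rational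
  point constant cancels (`TranslateX.ptQ_cancel`), so `GM` in `P` at `x + 1` gives `GM` in `P` at `x`
  (`TranslateX.gm_prod_eq`), which is converted back to the pinned form by `MultGlue.equiv_of_prod_eq`
  and `MultGlue.equivalent_of_equiv`.
References: Kontsevich–Zagier 2001 §1.2; Andrews–Askey–Roy 1999, §1.1 (`B(u+1,v) = B(u,v)·u/(u+v)`),
Thm 1.5.2 (Gauss multiplication).
-/

noncomputable section

open MeasureTheory Set Finset
open scoped BigOperators
open Literature.NumberTheory.Transcendental
open Literature.NumberTheory.Transcendental.KZ

namespace Summit.KontsevichZagierPeriods.TerasomaMultiplication.MultiplicationAccessible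

namespace TranslateX

/-! ## Rational point constants `⟦[pt, q]⟧` -/

/-- A rational number is real algebraic. [folklore] -/
theorem isAlgebraic_ratCast (q : ℚ) : IsAlgebraic ℚ ((q:ℚ):ℝ) := isAlgebraic_algebraMap q

/-- `⟦[pt, 1]⟧ = 1` for the rational `1` (`MultGlue.ptConst_one`). [folklore] -/
theorem ptQ_one : toFormalPeriod (of (IntegralRep.unit.constMul _ (isAlgebraic_ratCast 1))) = 1 :=
  (MultGlue.ptConst_congr (isAlgebraic_ratCast 1) isAlgebraic_one Rat.cast_one).trans
    (MultGlue.ptConst_one _)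

/-- `⟦[pt, pq]⟧ = ⟦[pt, p]⟧⟦[pt, q]⟧` for rationals `p, q` (`MultGlue.ptConst_mul`). [folklore] -/
theorem ptQ_mul (p q : ℚ) :
    toFormalPeriod (of (IntegralRep.unit.constMul _ (isAlgebraic_ratCast (p * q)))) =
      toFormalPeriod (of (IntegralRep.unit.constMul _ (isAlgebraic_ratCast p))) *
        toFormalPeriod (of (IntegralRep.unit.constMul _ (isAlgebraic_ratCast q))) :=
  (MultGlue.ptConst_congr (isAlgebraic_ratCast (p * q))
    ((isAlgebraic_ratCast p).mul (isAlgebraic_ratCast q)) (Rat.cast_mul p q)).trans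
    (MultGlue.ptConst_mul _ _ _)

/-- `⟦[pt, ∏ᵢ fᵢ]⟧ = ∏ᵢ ⟦[pt, fᵢ]⟧` for rationals `fᵢ`. [folklore] -/
theorem ptQ_prod {ι : Type*} (S : Finset ι) (f : ι → ℚ) :
    toFormalPeriod (of (IntegralRep.unit.constMul _ (isAlgebraic_ratCast (∏ i ∈ S, f i)))) =
      ∏ i ∈ S, toFormalPeriod (of (IntegralRep.unit.constMul _ (isAlgebraic_ratCast (f i)))) :=
  Finset.prod_hom_rel
    (r := fun b c => toFormalPeriod (of (IntegralRep.unit.constMul _ (isAlgebraic_ratCast b))) = c)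
    ptQ_one fun a b c h => by rw [ptQ_mul, h]

/-- **A nonzero rational point constant cancels**: `⟦[pt,q]⟧ A = ⟦[pt,q]⟧ B → A = B` for a rational
`q ≠ 0` (`⟦[pt,q⁻¹]⟧⟦[pt,q]⟧ = ⟦[pt,1]⟧ = 1`). [folklore] -/
theorem ptQ_cancel {q : ℚ} (hq : q ≠ 0) {A B : FormalPeriodRing}
    (h : toFormalPeriod (of (IntegralRep.unit.constMul _ (isAlgebraic_ratCast q))) * A =
      toFormalPeriod (of (IntegralRep.unit.constMul _ (isAlgebraic_ratCast q))) * B) :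
    A = B := by
  have hinv : toFormalPeriod (of (IntegralRep.unit.constMul _ (isAlgebraic_ratCast q⁻¹))) *
      toFormalPeriod (of (IntegralRep.unit.constMul _ (isAlgebraic_ratCast q))) = 1 := by
    rw [← ptQ_mul, inv_mul_cancel₀ hq, ptQ_one]
  calc A = toFormalPeriod (of (IntegralRep.unit.constMul _ (isAlgebraic_ratCast q⁻¹))) *
        toFormalPeriod (of (IntegralRep.unit.constMul _ (isAlgebraic_ratCast q))) * A := by
          rw [hinv, one_mul]
    _ = toFormalPeriod (of (IntegralRep.unit.constMul _ (isAlgebraic_ratCast q⁻¹))) *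
        (toFormalPeriod (of (IntegralRep.unit.constMul _ (isAlgebraic_ratCast q))) * B) := by
          rw [mul_assoc, h]
    _ = B := by rw [← mul_assoc, hinv, one_mul]

/-! ## Translations of Beta classes in `P` -/

/-- **Translation in the second argument**: `⟦[pt,a+b]⟧ g(a, b+1) = ⟦[pt,b]⟧ g(a, b)` for rational
`a, b > 0` — the integration-by-parts chain
`[(0,1), (a+b)t^(a−1)(1−t)^b] ∼ [(0,1), b t^(a−1)(1−t)^(b−1)]` (`KZ.betaTranslation_equivalent`, ONE
Newton–Leibniz move) between the two scaled pinned Beta representations, and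
`⟦κ·r⟧ = ⟦[pt,κ]⟧⟦r⟧` (`KZ.toFormalPeriod_of_constMul`). [cite: AndrewsAskeyRoy1999, §1.1] -/
theorem transl_snd_eq {B : ℚ → ℚ → IntegralRep 1}
    (hB : ∀ p q, 0 < p → 0 < q → (B p q).domain = {t | t 0 ∈ Set.Ioo (0:ℝ) 1} ∧
      (B p q).integrand = fun t => (t 0) ^ ((p:ℝ) - 1) * (1 - t 0) ^ ((q:ℝ) - 1))
    {a b : ℚ} (ha : 0 < a) (hb : 0 < b) :
    toFormalPeriod (of (IntegralRep.unit.constMul _ (isAlgebraic_ratCast (a + b)))) *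
        toFormalPeriod (of (B a (b + 1))) =
      toFormalPeriod (of (IntegralRep.unit.constMul _ (isAlgebraic_ratCast b))) *
        toFormalPeriod (of (B a b)) := by
  have hb1 : 0 < b + 1 := by linarith
  have e : Equivalent ((B a (b + 1)).constMul _ (isAlgebraic_ratCast (a + b)))
      ((B a b).constMul _ (isAlgebraic_ratCast b)) := by
    refine betaTranslation_equivalent a b ha hb _ _ ?_ (fun t _ => ?_) ?_ (fun t _ => ?_)
    · rw [IntegralRep.domain_constMul]
      exact (hB a (b + 1) ha hb1).1
    · simp only [IntegralRep.integrand_constMul, (hB a (b + 1) ha hb1).2]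
      rw [show (((b + 1 : ℚ)) : ℝ) - 1 = (b:ℝ) by push_cast; ring]
      push_cast
      ring
    · rw [IntegralRep.domain_constMul]
      exact (hB a b ha hb).1
    · simp only [IntegralRep.integrand_constMul, (hB a b ha hb).2]
  have h := e.toFormalPeriod_eq
  rwa [toFormalPeriod_of_constMul _ _ (B a (b + 1)), toFormalPeriod_of_constMul _ _ (B a b)] at h

/-- **Translation in the first argument**: `⟦[pt,a+b]⟧ g(a+1, b) = ⟦[pt,a]⟧ g(a, b)` for rational
`a, b > 0` (two reflections `g(p,q) = g(q,p)`, `Doubling.refl_eq`, around `transl_snd_eq`).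
[cite: AndrewsAskeyRoy1999, §1.1] -/
theorem transl_fst_eq {B : ℚ → ℚ → IntegralRep 1}
    (hB : ∀ p q, 0 < p → 0 < q → (B p q).domain = {t | t 0 ∈ Set.Ioo (0:ℝ) 1} ∧
      (B p q).integrand = fun t => (t 0) ^ ((p:ℝ) - 1) * (1 - t 0) ^ ((q:ℝ) - 1))
    {a b : ℚ} (ha : 0 < a) (hb : 0 < b) :
    toFormalPeriod (of (IntegralRep.unit.constMul _ (isAlgebraic_ratCast (a + b)))) *
        toFormalPeriod (of (B (a + 1) b)) =
      toFormalPeriod (of (IntegralRep.unit.constMul _ (isAlgebraic_ratCast a))) *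
        toFormalPeriod (of (B a b)) := by
  rw [Doubling.refl_eq hB (by linarith) hb, Doubling.refl_eq hB ha hb,
    show a + b = b + a from add_comm a b]
  exact transl_snd_eq hB hb ha

/-- **Iterated translation in the first argument**:
`⟦[pt, ∏_(i<j) (a+b+i)]⟧ g(a+j, b) = ⟦[pt, ∏_(i<j) (a+i)]⟧ g(a, b)` (`j` steps of `transl_fst_eq`).
[cite: AndrewsAskeyRoy1999, §1.1] -/
theorem transl_fst_iter_eq {B : ℚ → ℚ → IntegralRep 1}
    (hB : ∀ p q, 0 < p → 0 < q → (B p q).domain = {t | t 0 ∈ Set.Ioo (0:ℝ) 1} ∧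
      (B p q).integrand = fun t => (t 0) ^ ((p:ℝ) - 1) * (1 - t 0) ^ ((q:ℝ) - 1))
    {a b : ℚ} (ha : 0 < a) (hb : 0 < b) : ∀ j : ℕ,
    toFormalPeriod (of (IntegralRep.unit.constMul _
        (isAlgebraic_ratCast (∏ i ∈ range j, (a + b + i))))) * toFormalPeriod (of (B (a + j) b)) =
      toFormalPeriod (of (IntegralRep.unit.constMul _
        (isAlgebraic_ratCast (∏ i ∈ range j, (a + i))))) * toFormalPeriod (of (B a b))
  | 0 => by simp only [range_zero, Finset.prod_empty, ptQ_one, Nat.cast_zero, add_zero]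
  | j + 1 => by
    have ih := transl_fst_iter_eq hB ha hb j
    have key := transl_fst_eq hB (a := a + j) (b := b) (by positivity) hb
    rw [prod_range_succ, prod_range_succ, ptQ_mul, ptQ_mul, Nat.cast_succ,
      show a + b + (j:ℚ) = a + j + b by ring, show a + ((j:ℚ) + 1) = a + j + 1 by ring]
    linear_combination
      toFormalPeriod (of (IntegralRep.unit.constMul _
        (isAlgebraic_ratCast (∏ i ∈ range j, (a + b + i))))) * key
      + toFormalPeriod (of (IntegralRep.unit.constMul _ (isAlgebraic_ratCast (a + j)))) * ih

/-- **The left-hand side translated once in every factor** (`n = m + 1`):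
`⟦[pt, ∏_k (x + k/n + s)]⟧ ∏_k g(x + 1 + k/n, s) = ⟦[pt, ∏_k (x + k/n)]⟧ ∏_k g(x + k/n, s)`.
[cite: AndrewsAskeyRoy1999, §1.1] -/
theorem transl_prod_eq {B : ℚ → ℚ → IntegralRep 1}
    (hB : ∀ p q, 0 < p → 0 < q → (B p q).domain = {t | t 0 ∈ Set.Ioo (0:ℝ) 1} ∧
      (B p q).integrand = fun t => (t 0) ^ ((p:ℝ) - 1) * (1 - t 0) ^ ((q:ℝ) - 1))
    (m : ℕ) {x s : ℚ} (hx : 0 < x) (hs : 0 < s) :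
    toFormalPeriod (of (IntegralRep.unit.constMul _
        (isAlgebraic_ratCast (∏ k : Fin (m + 1), (x + (k : ℚ) / ((m : ℚ) + 1) + s))))) *
        ∏ k : Fin (m + 1), toFormalPeriod (of (B (x + 1 + (k : ℚ) / ((m : ℚ) + 1)) s)) =
      toFormalPeriod (of (IntegralRep.unit.constMul _
        (isAlgebraic_ratCast (∏ k : Fin (m + 1), (x + (k : ℚ) / ((m : ℚ) + 1)))))) *
        ∏ k : Fin (m + 1), toFormalPeriod (of (B (x + (k : ℚ) / ((m : ℚ) + 1)) s)) := by
  rw [ptQ_prod, ptQ_prod, ← prod_mul_distrib, ← prod_mul_distrib]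
  refine prod_congr rfl fun k _ => ?_
  rw [show x + 1 + (k : ℚ) / ((m : ℚ) + 1) = x + (k : ℚ) / ((m : ℚ) + 1) + 1 by ring]
  exact transl_fst_eq hB (by positivity) hs

/-- **The constants agree**:
`∏_k (x + k/n) · ∏_(i<n) (nx + ns + i) = ∏_k (x + k/n + s) · ∏_(i<n) (nx + i)` in `ℚ`
(termwise: `nx + ns + i = n(x + i/n + s)` and `nx + i = n(x + i/n)`). [folklore] -/
theorem const_eq (m : ℕ) (x s : ℚ) :
    (∏ k : Fin (m + 1), (x + (k : ℚ) / ((m : ℚ) + 1))) *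
        ∏ i ∈ range (m + 1), (((m : ℚ) + 1) * x + ((m : ℚ) + 1) * s + i) =
      (∏ k : Fin (m + 1), (x + (k : ℚ) / ((m : ℚ) + 1) + s)) *
        ∏ i ∈ range (m + 1), (((m : ℚ) + 1) * x + i) := by
  rw [← Fin.prod_univ_eq_prod_range (fun i => ((m : ℚ) + 1) * x + ((m : ℚ) + 1) * s + i) (m + 1),
    ← Fin.prod_univ_eq_prod_range (fun i => ((m : ℚ) + 1) * x + i) (m + 1), ← prod_mul_distrib,
    ← prod_mul_distrib]
  refine prod_congr rfl fun k _ => ?_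
  have hn : ((m : ℚ) + 1) ≠ 0 := by positivity
  field_simp
  ring

/-! ## The shifted family in `P` -/

/-- Splitting off coordinate `0` of the right-hand product:
`∏_k g(α'_k, β'_k) = g(ny, ns) · ∏_(j<m) g((j+1)s, s)`. [folklore] -/
theorem rhs_split (B : ℚ → ℚ → IntegralRep 1) (m : ℕ) (y s : ℚ) :
    ∏ k : Fin (m + 1), toFormalPeriod (of (B
        (if (k : ℕ) = 0 then ((m : ℚ) + 1) * y else (k : ℚ) * s)
        (if (k : ℕ) = 0 then ((m : ℚ) + 1) * s else s))) =
      toFormalPeriod (of (B (((m:ℚ) + 1) * y) (((m:ℚ) + 1) * s))) *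
        ∏ j : Fin m, toFormalPeriod (of (B ((((j:ℕ):ℚ) + 1) * s) s)) := by
  rw [Fin.prod_univ_succ]
  simp [Fin.val_succ]

/-- **Pinned `GM(m; x, s)` as an identity in `P`**: the pinned form (every box representation of the
left is equivalent to every box representation of the right) gives
`⟦[pt,1]⟧ ∏_k g(x + k/n, s) = ⟦[pt, n^(ns)]⟧ ∏_k g(α'_k, β'_k)` (`GlueFromParts.exists_of_forall`,
`MultGlue.prod_eq_of_equiv`). [cite: AndrewsAskeyRoy1999, Thm 1.5.2] -/
theorem prod_eq_of_pinned {B : ℚ → ℚ → IntegralRep 1}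
    (hB : ∀ p q, 0 < p → 0 < q → (B p q).domain = {t | t 0 ∈ Set.Ioo (0:ℝ) 1} ∧
      (B p q).integrand = fun t => (t 0) ^ ((p:ℝ) - 1) * (1 - t 0) ^ ((q:ℝ) - 1))
    (m : ℕ) {x s : ℚ} (hx : 0 < x) (hs : 0 < s)
    (h : ∀ (r r' : KZ.IntegralRep (m + 1)),
        r.domain = {z | ∀ i, z i ∈ Set.Ioo (0:ℝ) 1} →
        Set.EqOn r.integrand (fun z => ∏ k : Fin (m + 1),
          (z k) ^ ((x:ℝ) + ((k:ℕ):ℝ) / ((m:ℝ) + 1) - 1) * (1 - z k) ^ ((s:ℝ) - 1)) r.domain →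
        r'.domain = {z | ∀ i, z i ∈ Set.Ioo (0:ℝ) 1} →
        Set.EqOn r'.integrand (fun z => ((m:ℝ) + 1) ^ (((m:ℝ) + 1) * (s:ℝ)) *
          ((z 0) ^ (((m:ℝ) + 1) * (x:ℝ) - 1) * (1 - z 0) ^ (((m:ℝ) + 1) * (s:ℝ) - 1)) *
          ∏ j : Fin m, (z j.succ) ^ ((((j:ℕ):ℝ) + 1) * (s:ℝ) - 1) * (1 - z j.succ) ^ ((s:ℝ) - 1))
          r'.domain →
        KZ.Equivalent r r') :
    toFormalPeriod (of (IntegralRep.unit.constMul (1:ℝ) isAlgebraic_one)) *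
        ∏ k : Fin (m + 1), toFormalPeriod (of (B (x + (k : ℚ) / ((m : ℚ) + 1)) s)) =
      toFormalPeriod (of (IntegralRep.unit.constMul (((m:ℝ) + 1) ^ (((m:ℝ) + 1) * (s:ℝ)))
        (MultGlue.isAlgebraic_gaussConst m s))) *
        ∏ k : Fin (m + 1), toFormalPeriod (of (B
          (if (k : ℕ) = 0 then ((m : ℚ) + 1) * x else (k : ℚ) * s)
          (if (k : ℕ) = 0 then ((m : ℚ) + 1) * s else s))) :=
  MultGlue.prod_eq_of_equiv hB isAlgebraic_one (MultGlue.isAlgebraic_gaussConst m s)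
    (α := fun k : Fin (m + 1) => x + (k : ℚ) / ((m : ℚ) + 1)) (β := fun _ => s)
    (α' := fun k : Fin (m + 1) => if (k : ℕ) = 0 then ((m : ℚ) + 1) * x else (k : ℚ) * s)
    (β' := fun k : Fin (m + 1) => if (k : ℕ) = 0 then ((m : ℚ) + 1) * s else s)
    (fun k => by positivity) (fun _ => hs)
    (fun k => by split_ifs with h; exacts [by positivity, MultGlue.natCast_mul_pos h hs])
    (fun k => by split_ifs <;> positivity)
    (GlueFromParts.exists_of_forall m x s hx hs h)

/-- **`GM` in `P` at `x + 1` gives `GM` in `P` at `x`**: translate every left factor once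
(`transl_prod_eq`) and the right factor `g(n(x+1), ns) = g(nx + n, ns)` `n` times
(`transl_fst_iter_eq`); the rational constants agree (`const_eq`) and cancel (`ptQ_cancel`).
[cite: AndrewsAskeyRoy1999, Thm 1.5.2] -/
theorem gm_prod_eq {B : ℚ → ℚ → IntegralRep 1}
    (hB : ∀ p q, 0 < p → 0 < q → (B p q).domain = {t | t 0 ∈ Set.Ioo (0:ℝ) 1} ∧
      (B p q).integrand = fun t => (t 0) ^ ((p:ℝ) - 1) * (1 - t 0) ^ ((q:ℝ) - 1))
    (m : ℕ) {x s : ℚ} (hx : 0 < x) (hs : 0 < s)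
    (h1 : toFormalPeriod (of (IntegralRep.unit.constMul (1:ℝ) isAlgebraic_one)) *
        ∏ k : Fin (m + 1), toFormalPeriod (of (B (x + 1 + (k : ℚ) / ((m : ℚ) + 1)) s)) =
      toFormalPeriod (of (IntegralRep.unit.constMul (((m:ℝ) + 1) ^ (((m:ℝ) + 1) * (s:ℝ)))
        (MultGlue.isAlgebraic_gaussConst m s))) *
        ∏ k : Fin (m + 1), toFormalPeriod (of (B
          (if (k : ℕ) = 0 then ((m : ℚ) + 1) * (x + 1) else (k : ℚ) * s)
          (if (k : ℕ) = 0 then ((m : ℚ) + 1) * s else s)))) :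
    toFormalPeriod (of (IntegralRep.unit.constMul (1:ℝ) isAlgebraic_one)) *
        ∏ k : Fin (m + 1), toFormalPeriod (of (B (x + (k : ℚ) / ((m : ℚ) + 1)) s)) =
      toFormalPeriod (of (IntegralRep.unit.constMul (((m:ℝ) + 1) ^ (((m:ℝ) + 1) * (s:ℝ)))
        (MultGlue.isAlgebraic_gaussConst m s))) *
        ∏ k : Fin (m + 1), toFormalPeriod (of (B
          (if (k : ℕ) = 0 then ((m : ℚ) + 1) * x else (k : ℚ) * s)
          (if (k : ℕ) = 0 then ((m : ℚ) + 1) * s else s))) := by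
  rw [MultGlue.ptConst_one, one_mul, rhs_split] at h1 ⊢
  -- (A) the left-hand side, (B) the right-hand factor `g(nx + n, ns)`, (C) the constants
  have hA := transl_prod_eq hB m hx hs
  have hBB := transl_fst_iter_eq hB (a := ((m : ℚ) + 1) * x) (b := ((m : ℚ) + 1) * s)
    (by positivity) (by positivity) (m + 1)
  rw [show ((m : ℚ) + 1) * x + ((m + 1 : ℕ) : ℚ) = ((m : ℚ) + 1) * (x + 1) by push_cast; ring]
    at hBB
  have hC : toFormalPeriod (of (IntegralRep.unit.constMul _
        (isAlgebraic_ratCast (∏ k : Fin (m + 1), (x + (k : ℚ) / ((m : ℚ) + 1)))))) *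
      toFormalPeriod (of (IntegralRep.unit.constMul _
        (isAlgebraic_ratCast (∏ i ∈ range (m + 1), (((m : ℚ) + 1) * x + ((m : ℚ) + 1) * s + i))))) =
      toFormalPeriod (of (IntegralRep.unit.constMul _
        (isAlgebraic_ratCast (∏ k : Fin (m + 1), (x + (k : ℚ) / ((m : ℚ) + 1) + s))))) *
      toFormalPeriod (of (IntegralRep.unit.constMul _
        (isAlgebraic_ratCast (∏ i ∈ range (m + 1), (((m : ℚ) + 1) * x + i))))) := by
    rw [← ptQ_mul, ← ptQ_mul, const_eq]
  -- cancel the nonzero rational constant `∏_k (x + k/n) · ∏_i (nx + ns + i)`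
  have hne : (∏ k : Fin (m + 1), (x + (k : ℚ) / ((m : ℚ) + 1))) *
      ∏ i ∈ range (m + 1), (((m : ℚ) + 1) * x + ((m : ℚ) + 1) * s + i) ≠ 0 :=
    (mul_pos (prod_pos fun k _ => by positivity) (prod_pos fun i _ => by positivity)).ne'
  refine ptQ_cancel hne ?_
  rw [ptQ_mul]
  linear_combination
    (-(toFormalPeriod (of (IntegralRep.unit.constMul _ (isAlgebraic_ratCast
        (∏ i ∈ range (m + 1), (((m : ℚ) + 1) * x + ((m : ℚ) + 1) * s + i))))))) * hA
    + (toFormalPeriod (of (IntegralRep.unit.constMul _ (isAlgebraic_ratCast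
          (∏ i ∈ range (m + 1), (((m : ℚ) + 1) * x + ((m : ℚ) + 1) * s + i))))) *
        toFormalPeriod (of (IntegralRep.unit.constMul _ (isAlgebraic_ratCast
          (∏ k : Fin (m + 1), (x + (k : ℚ) / ((m : ℚ) + 1) + s)))))) * h1
    + (toFormalPeriod (of (IntegralRep.unit.constMul _ (isAlgebraic_ratCast
          (∏ k : Fin (m + 1), (x + (k : ℚ) / ((m : ℚ) + 1) + s))))) *
        toFormalPeriod (of (IntegralRep.unit.constMul (((m:ℝ) + 1) ^ (((m:ℝ) + 1) * (s:ℝ)))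
          (MultGlue.isAlgebraic_gaussConst m s))) *
        ∏ j : Fin m, toFormalPeriod (of (B ((((j:ℕ):ℚ) + 1) * s) s))) * hBB
    - (toFormalPeriod (of (IntegralRep.unit.constMul (((m:ℝ) + 1) ^ (((m:ℝ) + 1) * (s:ℝ)))
          (MultGlue.isAlgebraic_gaussConst m s))) *
        toFormalPeriod (of (B (((m:ℚ) + 1) * x) (((m:ℚ) + 1) * s))) *
        ∏ j : Fin m, toFormalPeriod (of (B ((((j:ℕ):ℚ) + 1) * s) s))) * hC

end TranslateX

/-- **Registered sub-goal `gm_of_gm_succ_x`** (the `x`-translation of the shifted family): for every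
`m` and rational `x, s > 0`, the shifted Gauss multiplication `GM(m; x+1, s)` inside the
Kontsevich–Zagier rules (pinned form) implies `GM(m; x, s)` — in the formal period ring the two differ
by `n + n` translations `B(u+1, v) = B(u, v)·u/(u+v)` (one Newton–Leibniz move each) and a nonzero
rational point constant, which is a unit (`TranslateX.gm_prod_eq`); the pinned forms are converted by
`TranslateX.prod_eq_of_pinned`, `MultGlue.equiv_of_prod_eq`, `MultGlue.equivalent_of_equiv`.
[cite: AndrewsAskeyRoy1999, Thm 1.5.2] -/
theorem gm_of_gm_succ_x :
    ∀ (m : ℕ) (x s : ℚ), 0 < x → 0 < s →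
      (∀ (r r' : KZ.IntegralRep (m + 1)),
        r.domain = {z | ∀ i, z i ∈ Set.Ioo (0:ℝ) 1} →
        Set.EqOn r.integrand (fun z => ∏ k : Fin (m + 1),
          (z k) ^ ((((x + 1 : ℚ)):ℝ) + ((k:ℕ):ℝ) / ((m:ℝ) + 1) - 1) * (1 - z k) ^ ((s:ℝ) - 1))
          r.domain →
        r'.domain = {z | ∀ i, z i ∈ Set.Ioo (0:ℝ) 1} →
        Set.EqOn r'.integrand (fun z => ((m:ℝ) + 1) ^ (((m:ℝ) + 1) * (s:ℝ)) *
          ((z 0) ^ (((m:ℝ) + 1) * (((x + 1 : ℚ)):ℝ) - 1) * (1 - z 0) ^ (((m:ℝ) + 1) * (s:ℝ) - 1)) *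
          ∏ j : Fin m, (z j.succ) ^ ((((j:ℕ):ℝ) + 1) * (s:ℝ) - 1) * (1 - z j.succ) ^ ((s:ℝ) - 1))
          r'.domain →
        KZ.Equivalent r r') →
      ∀ (r r' : KZ.IntegralRep (m + 1)),
        r.domain = {z | ∀ i, z i ∈ Set.Ioo (0:ℝ) 1} →
        Set.EqOn r.integrand (fun z => ∏ k : Fin (m + 1),
          (z k) ^ ((x:ℝ) + ((k:ℕ):ℝ) / ((m:ℝ) + 1) - 1) * (1 - z k) ^ ((s:ℝ) - 1)) r.domain →
        r'.domain = {z | ∀ i, z i ∈ Set.Ioo (0:ℝ) 1} →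
        Set.EqOn r'.integrand (fun z => ((m:ℝ) + 1) ^ (((m:ℝ) + 1) * (s:ℝ)) *
          ((z 0) ^ (((m:ℝ) + 1) * (x:ℝ) - 1) * (1 - z 0) ^ (((m:ℝ) + 1) * (s:ℝ) - 1)) *
          ∏ j : Fin m, (z j.succ) ^ ((((j:ℕ):ℝ) + 1) * (s:ℝ) - 1) * (1 - z j.succ) ^ ((s:ℝ) - 1))
          r'.domain →
        KZ.Equivalent r r' := by
  intro m x s hx hs hGM r r' hr hri hr' hri'
  obtain ⟨B, hB⟩ := MultGlue.exists_betaFamily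
  have hx1 : (0:ℚ) < x + 1 := by positivity
  have hP := TranslateX.gm_prod_eq hB m hx hs (TranslateX.prod_eq_of_pinned hB m hx1 hs hGM)
  have hex := MultGlue.equiv_of_prod_eq hB isAlgebraic_one (MultGlue.isAlgebraic_gaussConst m s)
    (α := fun k : Fin (m + 1) => x + (k : ℚ) / ((m : ℚ) + 1)) (β := fun _ => s)
    (α' := fun k : Fin (m + 1) => if (k : ℕ) = 0 then ((m : ℚ) + 1) * x else (k : ℚ) * s)
    (β' := fun k : Fin (m + 1) => if (k : ℕ) = 0 then ((m : ℚ) + 1) * s else s)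
    (fun k => by positivity) (fun _ => hs)
    (fun k => by split_ifs with h; exacts [by positivity, MultGlue.natCast_mul_pos h hs])
    (fun k => by split_ifs <;> positivity) hP
  exact MultGlue.equivalent_of_equiv hex r r' hr
    (fun z hz => (hri hz).trans (GlueFromParts.gmLeft_eq m x s z).symm) hr'
    (fun z hz => (hri' hz).trans (GlueFromParts.gmRight_eq m x s z).symm)

end Summit.KontsevichZagierPeriods.TerasomaMultiplication.MultiplicationAccessible

end
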